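import Mathlib

/-!
# Mahler measure of polynomials with few monomials (Dobrowolski 2006; Dobrowolski–Smyth 2017)

[cite: Dobrowolski2006, Proposition 2 p.203, Proposition 1 p.203] and [cite: DobrowolskiSmyth2017, Theorem 1].

Printed statements.  E. Dobrowolski, *Mahler's measure of a polynomial in terms of the number of its
monomials*, Acta Arith. 123 (2006) 201–231:
* Proposition 2 (p.203): "Let `f ∈ ℤ[x]`, `f(0) ≠ 0`, be a monic quadrinomial that is not a product of
  cyclotomic factors. Then `M(f) ≥ θ`."  Here (p.202) "`θ > 1.32` denotes the real zero of the polynomial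
  `x³ - x + 1`" up to sign — i.e. `θ = θ₀ = 1.3247…`, the real root of `x³ = x + 1`, `= M(x³ - x - 1)`; a
  *quadrinomial* is a polynomial with exactly four nonzero coefficients.  (§7 p.230: the bound is attained by
  the nonreciprocal `x⁴ - x³ - x² + 1 = (x - 1)(x³ - x - 1)`; quoted in Smyth, Proc. AMS 146 (2018) §8 as
  "the minimal Mahler measure of all integer noncyclotomic quadrinomials".)
* Proposition 1 (p.203): "Let `f ∈ ℤ[x]` be a monic irreducible polynomial with `k` nonzero terms. If `f` is
  not cyclotomic then `M(f) ≥ 1 + 0.17/(2^m m!)`, where `m = ⌈k/2⌉`."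
E. Dobrowolski and C. Smyth, *Mahler measures of polynomials that are sums of a bounded number of
monomials*, Int. J. Number Theory 13 (2017) 1603–1610, Theorem 1: "For an integer `k ≥ 2`, let
`f(z) = a₁ z^{n₁} + ⋯ + a_{k-1} z^{n_{k-1}} + a_k ∈ ℂ[z]` with `n₁ > n₂ > ⋯ > n_{k-1} > 0` be a nonzero
polynomial. Then `M(f) ≥ h(f)/2^{k-2}`", `h(f)` the height (maximum modulus of the coefficients); we
record the integer-coefficient case.

Vocabulary: Mathlib's `Polynomial.mahlerMeasure` of the image over `ℂ`; "`k` nonzero coefficients" is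
`f.support.card = k`; "not a product of cyclotomic factors" (for monic `f`) is stated literally with
`Polynomial.cyclotomic`.  Typed statements only (named facts); nothing is proved here.  Consequence used by
the small-measure census of cell `pub-namedobj` (venture `DiscreteObjects`, target L): an integer polynomial
with Mahler measure in `(1, θ₀)` — in particular a sub-Lehmer one — has at least five monomials; the cell's
files `Summits/Ventures/DiscreteObjects/Mahler/SparseSubLehmer.lean` etc. re-derive the weaker form
`M ∉ (1, M(ℓ))` of Proposition 2 inside the kernel.
-/

namespace Literature.NumberTheory.MahlerMeasure

open Polynomial

/-- **Dobrowolski's quadrinomial bound** [cite: Dobrowolski2006, Proposition 2 p.203]: a monic `f ∈ ℤ[x]`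
with `f(0) ≠ 0` and exactly four nonzero coefficients which is not a product of cyclotomic polynomials has
`M(f) ≥ θ₀ = M(x³ - x - 1)` (`= 1.3247…`). -/
def QuadrinomialMahlerBound : Prop :=
  ∀ f : ℤ[X], f.Monic → f.coeff 0 ≠ 0 → f.support.card = 4 →
    (∀ s : Multiset ℕ, f ≠ (s.map fun m => cyclotomic m ℤ).prod) →
      ((X ^ 3 - X - 1 : ℤ[X]).map (Int.castRingHom ℂ)).mahlerMeasure ≤
        (f.map (Int.castRingHom ℂ)).mahlerMeasure

/-- **Dobrowolski's bound for irreducible `k`-nomials** [cite: Dobrowolski2006, Proposition 1 p.203]: a monic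
irreducible noncyclotomic `f ∈ ℤ[x]`, `f(0) ≠ 0`, with `k` nonzero terms has `M(f) ≥ 1 + 0.17/(2^m · m!)`,
`m = ⌈k/2⌉`.  (*Noncyclotomic* for an irreducible monic `f`: `f ≠ Φ_n` for every `n ≥ 1`.  The hypothesis
`f(0) ≠ 0` — explicit in the paper's Theorem 2, Corollary 1 and Proposition 2 but left implicit in the
printed Proposition 1 — is needed: `f = x` is monic, irreducible, not cyclotomic, has `k = 1` and `M = 1`,
violating the inequality.  Corrected 2026-08-25 after the cell referee's finding; the first filing had typed
the sentence verbatim without it.) -/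
def IrreducibleFewnomialMahlerBound : Prop :=
  ∀ f : ℤ[X], f.Monic → Irreducible f → f.coeff 0 ≠ 0 → (∀ n : ℕ, 0 < n → f ≠ cyclotomic n ℤ) →
    (1 : ℝ) + (17 / 100) / (2 ^ ((f.support.card + 1) / 2) * ((f.support.card + 1) / 2).factorial) ≤
      (f.map (Int.castRingHom ℂ)).mahlerMeasure

/-- **Dobrowolski–Smyth height bound for `k`-nomials** [cite: DobrowolskiSmyth2017, Theorem 1] (integer
case): a nonzero `f ∈ ℤ[z]` with `k ≥ 2` nonzero coefficients has `M(f) ≥ h(f)/2^{k-2}`, `h(f)` the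
maximum of the `|a_i|`. -/
def FewnomialHeightMahlerBound : Prop :=
  ∀ f : ℤ[X], 2 ≤ f.support.card →
    ((f.support.sup fun i => (f.coeff i).natAbs : ℕ) : ℝ) / 2 ^ (f.support.card - 2) ≤
      (f.map (Int.castRingHom ℂ)).mahlerMeasure

end Literature.NumberTheory.MahlerMeasure
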